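import Literature.MathematicalPhysics.QuantumFieldTheory.Balaban1983to89.B9Eq349ConjugatedQGGQInvLetters

/-!
# `Balaban1983to89.B9Eq349ConjugatedProjectionDifferenceLetters` — T. Bałaban, *Propagators for lattice gauge theories in a background field*, Commun.
# Math. Phys. **99** (1985) 389–434 [Balaban1985BackgroundPropagators] (3.21)∕(3.25) p. 394, (3.49) p. 399, Thm 3.11 p. 416: **THE CONJUGATED PROJECTION
# AGAINST THE PROJECTION — `‖P_κx − Px‖ ≤ β·ρ₀·‖x‖` for `P = A∘T`, `A = GQ′†`, `T = cQ′G`, `c = (Q′GGQ′†)⁻¹` and the conjugated word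
# `P_κ = A_κ∘T_κ`, `A_κ = G_κQ_κ′`, `T_κ = c_κQ_κG_κ`** — abstract finite-dimensional `𝕜`-Hilbert letters: the two seams of `B9Eq349ConjugatedGreenLetters` ∕
# `B9Eq349ConjugatedQGGQInvLetters` (`‖A_κ − A‖, ‖Q_κG_κ − Q′G‖ ≤ β·s_A`), the Gram comparison `‖X_κ − X‖ ≤ β·s_X` and the inverse bounds `‖c‖ ≤ κ₁⁻¹`,
# `‖c_κ‖ ≤ 2∕κ₁`; the letter `ρ = β·ρ₀` of `B9Eq326ConjugatedDeltaALetters` (`‖R_κ − R‖ ≤ ρ` for `R = 1 − P`, the projected square of `Δ_a`)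

statement-level skeleton of published theorems with citation tags; proofs where landed; nothing here is a claim about the Yang–Mills mass gap

CITATION HEADER (lean-in-tree rule).  Audit cell `pub-balaban`, sub-cell `t4`, BINDER row NE9; filed by NE9 formalisation-swarm leaf prover 03
(`b2b-balaban-t4-ne9-formalise-leaf-03`, gen 75).  Imports this lineage's `B9Eq349ConjugatedQGGQInvLetters` (gen 74; through it ne9-leaf-05's
`B9Eq349ConjugatedGreenLetters`); Mathlib otherwise.  Sources READ first-hand (`paper:balaban1985-cmp99-background-propagators`, journal page = PDF page + 388):
p. 394 (3.21) *«R … the orthogonal projection onto Δ^η_U N(Q′)»*, (3.25) *«Rf = (I − G′Q′*(Q′G′²Q′*)⁻¹Q′G′)f»*, p. 399 (3.49) (print's kernels of `P = I − R`),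
p. 416 Thm 3.11.  Print's road is the random walk; the conjugation is the ROUTE's Combes–Thomas substitute; nothing of print's is asserted.

WHY THIS FILE (cell context; PRE-INTENT [NE9LEAF03-G75-PREINTENT-1]).  `B9Eq326ConjugatedDeltaALetters.coercive_k_projected` takes the letter
`‖R_κ − R‖ ≤ ρ ≤ 1∕8` for the conjugated orthogonal projection `R_κ = S_SR(U)S_S⁻¹`; since `1 − R(U) = P(U) = A∘T` ((3.25), ne9-leaf-06's
`B9Eq349ConjugatedProjectionChain.one_sub_RofU_apply_eq`) and `S_S(A∘T)S_S⁻¹ = (S_SAS_G⁻¹)∘(S_GTS_S⁻¹) = A_κ∘T_κ`, the letter is `‖A_κT_κ − AT‖`, a word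
in the seams the chain already holds.  This file does the word abstractly; the instance at the chain's `±` families (`B9Eq349ConjugatedDPChainLetters`) is
the next brick.

WHAT IS PROVED (sorry-free; proof lane — no `def`; [folklore] Hilbert-space bookkeeping).  Letters as in `B9Eq349ConjugatedQGGQInvLetters` §1 (`D`, `Q′`,
`a`, `γ`, `C_Q`, `β`, the conjugated `D_κ, D_κ′, Q_κ, Q_κ′`, `H = D†D + aQ′†Q′`, `H_κ`, `G`, `G_κ` with `HG = 1`, `H_κG_κ = 1 = G_κH_κ`, the coercivity
`γ‖f‖² ≤ ‖Df‖² + a‖Q′f‖²`, the `β`-letters, the window `3(1+a)β² ≤ γ∕4`), plus the Gram data: `κ₁‖g‖² ≤ re⟪g, Xg⟫` (`X = Q′GGQ′†`), `c` with `X(cv) = v`,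
`c_κ` with `X_κ(c_κv) = v` and `c_κ(X_κw) = w` (`X_κ = Q_κG_κG_κQ_κ′`), and the window `β·s_X ≤ κ₁∕2`.
* §1 `norm_c_le` (`‖cv‖ ≤ κ₁⁻¹‖v‖`), `norm_ck_sub_c_le` (`‖c_κv − cv‖ ≤ β·(2s_X∕κ₁²)·‖v‖`), `norm_T_le` (`‖c(Q′(Gx))‖ ≤ (C_Q∕κ₁)(4∕γ)‖x‖`),
  `norm_Tk_sub_T_le`, `norm_Ak_le`.
* §2 **`norm_Pk_sub_P_le`** — `‖G_κ(Q_κ′(c_κ(Q_κ(G_κx)))) − G(Q′†(c(Q′(Gx))))‖ ≤ β·ρ₀·‖x‖` with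
  `ρ₀ = (4∕γ)(C_Q + 1)·((2∕κ₁)s_A + (2s_X∕κ₁²)·C_Q(4∕γ)) + s_A·(C_Q∕κ₁)(4∕γ)`, `s_A = 4∕γ + C_Q(4∕γ)²(3 + a(2C_Q + 1))`, `s_X = s_A(4∕γ)(2C_Q + 1)`.
HONEST SCOPE.  Symbolic: no lattice; `γ`, `C_Q`, `κ₁` displayed (KAPPA1 load-bearing); no decay rate, no number; ONE letter of ONE sub-step, NOT NE9 (cell
pub-balaban: NE9 NOT PRINTED ∕ NOT PROVED; «NE9 ⇐ the named binders»; row WALLED ON A MODEL (O-NE9-1; #5 UNRULED); spine PROVED 0∕9; rung (B)+1 on a finite T⁴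
— NOT infinite volume, NOT mass gap, NOT BetaPertH, NOT Clay; HONEST DEPENDENCY: continuum YM on T⁴ ⇐ BetaPertH ∧ nine spine estimates (0/9 proved); BetaPertH
⇐ (D1) ∧ (D4) ∧ CAP+tail).  NEW file; nothing modified.  Net new unproved facts: 0.
-/

namespace Literature.MathematicalPhysics.QuantumFieldTheory.Balaban1983to89.B9Eq349ConjugatedProjectionDifferenceLetters

open scoped InnerProductSpace
open B9Eq349ConjugatedGreenLetters (norm_Gk_le norm_G_le norm_Qk_le norm_Qk'_le norm_Gk_Qk'_sub_G_adjQ_le)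
open B9Eq349ConjugatedQGGQInvLetters (norm_Qk_Gk_sub_Q_G_le norm_Xk_sub_X_le norm_ck_le)

variable {𝕜 : Type*} [RCLike 𝕜]
variable {S E F : Type*} [NormedAddCommGroup S] [InnerProductSpace 𝕜 S] [NormedAddCommGroup E] [InnerProductSpace 𝕜 E]
  [NormedAddCommGroup F] [InnerProductSpace 𝕜 F] [FiniteDimensional 𝕜 S] [FiniteDimensional 𝕜 E] [FiniteDimensional 𝕜 F]

variable (D : S →ₗ[𝕜] E) (Q' : S →ₗ[𝕜] F) (a γ CQ β κ₁ : ℝ)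
  (Dk : S →ₗ[𝕜] E) (Dk' : E →ₗ[𝕜] S) (Qk : S →ₗ[𝕜] F) (Qk' : F →ₗ[𝕜] S) (H Hk G Gk : S →ₗ[𝕜] S) (c ck : F →ₗ[𝕜] F)
  (ha : 0 ≤ a) (hγ : 0 < γ) (hγ1 : γ ≤ 1) (hCQ : 0 ≤ CQ) (hβ : 0 ≤ β) (hβ1 : β ≤ 1) (hκ₁ : 0 < κ₁)
  (coercive : ∀ f, γ * ‖f‖ ^ 2 ≤ ‖D f‖ ^ 2 + a * ‖Q' f‖ ^ 2) (hQ : ∀ s, ‖Q' s‖ ≤ CQ * ‖s‖)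
  (dD : ∀ s, ‖Dk s - D s‖ ≤ β * ‖s‖) (dD' : ∀ e, ‖Dk' e - LinearMap.adjoint D e‖ ≤ β * ‖e‖)
  (dQ : ∀ s, ‖Qk s - Q' s‖ ≤ β * ‖s‖) (dQ' : ∀ g, ‖Qk' g - LinearMap.adjoint Q' g‖ ≤ β * ‖g‖)
  (small : 3 * (1 + a) * β ^ 2 ≤ γ / 4)
  (hH : ∀ f, H f = LinearMap.adjoint D (D f) + ((a : ℝ) : 𝕜) • LinearMap.adjoint Q' (Q' f)) (hHG : ∀ v, H (G v) = v)
  (hHk : ∀ f, Hk f = Dk' (Dk f) + ((a : ℝ) : 𝕜) • Qk' (Qk f)) (hHkGk : ∀ v, Hk (Gk v) = v) (hGkHk : ∀ s, Gk (Hk s) = s)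
  (hX : ∀ g : F, κ₁ * ‖g‖ ^ 2 ≤ RCLike.re ⟪g, Q' (G (G (LinearMap.adjoint Q' g)))⟫_𝕜)
  (hc : ∀ v, Q' (G (G (LinearMap.adjoint Q' (c v)))) = v)
  (hck : ∀ v, Qk (Gk (Gk (Qk' (ck v)))) = v) (hkc : ∀ w, ck (Qk (Gk (Gk (Qk' w)))) = w)
  (small2 : β * ((4 / γ + CQ * ((4 / γ) ^ 2 * (3 + a * (2 * CQ + 1)))) * (4 / γ) * (2 * CQ + 1)) ≤ κ₁ / 2)

/-! ## §1 Sizes of the factors and of their differences -/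

include hκ₁ hX hc in
/-- **`‖cv‖ ≤ κ₁⁻¹‖v‖`** for the inverse Gram operator: `κ₁‖cv‖² ≤ re⟪cv, X(cv)⟫ = re⟪cv, v⟫ ≤ ‖cv‖‖v‖`. [folklore]
[cite: Balaban1985BackgroundPropagators, Thm 3.11 p.416, (3.25) p.394] -/
theorem norm_c_le (v : F) : ‖c v‖ ≤ κ₁⁻¹ * ‖v‖ := by
  have h1 := hX (c v)
  rw [hc] at h1
  have h2 : RCLike.re ⟪c v, v⟫_𝕜 ≤ ‖c v‖ * ‖v‖ := (RCLike.re_le_norm _).trans (norm_inner_le_norm _ _)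
  by_cases hx : c v = 0
  · rw [hx, norm_zero]; positivity
  · have hxpos : 0 < ‖c v‖ := norm_pos_iff.mpr hx
    rw [← div_eq_inv_mul, le_div_iff₀ hκ₁]
    nlinarith [h1, h2, hxpos]

include ha hγ hγ1 hCQ hβ hβ1 hκ₁ coercive hQ dD dD' dQ dQ' small hH hHG hHk hHkGk hGkHk hX hc hck hkc small2 in
/-- **`‖c_κv − cv‖ ≤ β·(2s_X∕κ₁²)·‖v‖`**: `c_κv − cv = c_κ((X − X_κ)(cv))` (`c_κX_κ = 1`, `Xc = 1`), `‖c_κ‖ ≤ 2∕κ₁`, `‖X_κ − X‖ ≤ β·s_X`, `‖c‖ ≤ κ₁⁻¹`.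
[folklore] [cite: Balaban1985BackgroundPropagators, Thm 3.11 p.416, (3.25) p.394, (3.49) p.399] -/
theorem norm_ck_sub_c_le (v : F) :
    ‖ck v - c v‖ ≤ β * (2 / κ₁ * ((4 / γ + CQ * ((4 / γ) ^ 2 * (3 + a * (2 * CQ + 1)))) * (4 / γ) * (2 * CQ + 1)) * κ₁⁻¹) * ‖v‖ := by
  have e : ck v - c v = ck (Q' (G (G (LinearMap.adjoint Q' (c v)))) - Qk (Gk (Gk (Qk' (c v))))) := by
    rw [map_sub, hc, hkc]
  rw [e]
  have h1 := norm_ck_le D Q' a γ CQ β Dk Dk' Qk Qk' H Hk G Gk ha hγ hγ1 hCQ hβ hβ1 coercive hQ dD dD' dQ dQ' small hH hHG hHk hHkGk hGkHk hκ₁ hX ck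
    hck small2 (Q' (G (G (LinearMap.adjoint Q' (c v)))) - Qk (Gk (Gk (Qk' (c v)))))
  have h2 := norm_Xk_sub_X_le D Q' a γ CQ β Dk Dk' Qk Qk' H Hk G Gk ha hγ hγ1 hCQ hβ hβ1 coercive hQ dD dD' dQ dQ' small hH hHG hHk hHkGk hGkHk
    (c v)
  have h3 := norm_c_le Q' κ₁ G c hκ₁ hX hc v
  have hsX : 0 ≤ (4 / γ + CQ * ((4 / γ) ^ 2 * (3 + a * (2 * CQ + 1)))) * (4 / γ) * (2 * CQ + 1) := by positivity
  calc ‖ck (Q' (G (G (LinearMap.adjoint Q' (c v)))) - Qk (Gk (Gk (Qk' (c v)))))‖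
      ≤ 2 / κ₁ * ‖Q' (G (G (LinearMap.adjoint Q' (c v)))) - Qk (Gk (Gk (Qk' (c v))))‖ := h1
    _ ≤ 2 / κ₁ * (β * ((4 / γ + CQ * ((4 / γ) ^ 2 * (3 + a * (2 * CQ + 1)))) * (4 / γ) * (2 * CQ + 1)) * (κ₁⁻¹ * ‖v‖)) := by
        rw [norm_sub_rev] at h2
        exact mul_le_mul_of_nonneg_left (h2.trans (mul_le_mul_of_nonneg_left h3 (by positivity))) (by positivity)
    _ = _ := by ring

include ha hγ hCQ hκ₁ coercive hQ hH hHG hX hc in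
/-- **`‖c(Q′(Gx))‖ ≤ (C_Q∕κ₁)(4∕γ)‖x‖`.** [folklore] [cite: Balaban1985BackgroundPropagators, (3.25) p.394, Thm 3.11 p.416] -/
theorem norm_T_le (x : S) : ‖c (Q' (G x))‖ ≤ κ₁⁻¹ * CQ * (4 / γ) * ‖x‖ := by
  have h1 := norm_c_le Q' κ₁ G c hκ₁ hX hc (Q' (G x))
  have h2 := (hQ (G x)).trans (mul_le_mul_of_nonneg_left (norm_G_le D Q' a γ H G ha hγ coercive hH hHG x) hCQ)
  calc ‖c (Q' (G x))‖ ≤ κ₁⁻¹ * ‖Q' (G x)‖ := h1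
    _ ≤ κ₁⁻¹ * (CQ * (4 / γ * ‖x‖)) := mul_le_mul_of_nonneg_left h2 (inv_nonneg.2 hκ₁.le)
    _ = _ := by ring

include ha hγ hγ1 hCQ hβ hβ1 hκ₁ coercive hQ dD dD' dQ dQ' small hH hHG hHk hHkGk hGkHk hX hc hck hkc small2 in
/-- **`‖c_κ(Q_κ(G_κx)) − c(Q′(Gx))‖ ≤ β·t₀·‖x‖`** with `t₀ = (2∕κ₁)s_A + (2s_X∕κ₁²)·C_Q(4∕γ)`: `T_κ − T = c_κ(Q_κG_κ − Q′G) + (c_κ − c)Q′G`. [folklore]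
[cite: Balaban1985BackgroundPropagators, (3.25) p.394, (3.49) p.399, Thm 3.11 p.416] -/
theorem norm_Tk_sub_T_le (x : S) :
    ‖ck (Qk (Gk x)) - c (Q' (G x))‖ ≤
      β * (2 / κ₁ * (4 / γ + CQ * ((4 / γ) ^ 2 * (3 + a * (2 * CQ + 1)))) +
        2 / κ₁ * ((4 / γ + CQ * ((4 / γ) ^ 2 * (3 + a * (2 * CQ + 1)))) * (4 / γ) * (2 * CQ + 1)) * κ₁⁻¹ * (CQ * (4 / γ))) * ‖x‖ := by
  have e : ck (Qk (Gk x)) - c (Q' (G x)) = ck (Qk (Gk x) - Q' (G x)) + (ck (Q' (G x)) - c (Q' (G x))) := by rw [map_sub]; abel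
  have h1 := norm_ck_le D Q' a γ CQ β Dk Dk' Qk Qk' H Hk G Gk ha hγ hγ1 hCQ hβ hβ1 coercive hQ dD dD' dQ dQ' small hH hHG hHk hHkGk hGkHk hκ₁ hX ck
    hck small2 (Qk (Gk x) - Q' (G x))
  have h2 := norm_Qk_Gk_sub_Q_G_le D Q' a γ CQ β Dk Dk' Qk Qk' H Hk G Gk ha hγ hγ1 hCQ hβ hβ1 coercive hQ dD dD' dQ dQ' small hH hHG hHk hHkGk hGkHk x
  have h3 := norm_ck_sub_c_le D Q' a γ CQ β κ₁ Dk Dk' Qk Qk' H Hk G Gk c ck ha hγ hγ1 hCQ hβ hβ1 hκ₁ coercive hQ dD dD' dQ dQ' small hH hHG hHk hHkGk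
    hGkHk hX hc hck hkc small2 (Q' (G x))
  have h4 := (hQ (G x)).trans (mul_le_mul_of_nonneg_left (norm_G_le D Q' a γ H G ha hγ coercive hH hHG x) hCQ)
  have hsA : 0 ≤ 4 / γ + CQ * ((4 / γ) ^ 2 * (3 + a * (2 * CQ + 1))) := by positivity
  calc ‖ck (Qk (Gk x)) - c (Q' (G x))‖ ≤ ‖ck (Qk (Gk x) - Q' (G x))‖ + ‖ck (Q' (G x)) - c (Q' (G x))‖ := by rw [e]; exact norm_add_le _ _
    _ ≤ 2 / κ₁ * (β * (4 / γ + CQ * ((4 / γ) ^ 2 * (3 + a * (2 * CQ + 1)))) * ‖x‖) +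
        β * (2 / κ₁ * ((4 / γ + CQ * ((4 / γ) ^ 2 * (3 + a * (2 * CQ + 1)))) * (4 / γ) * (2 * CQ + 1)) * κ₁⁻¹) * (CQ * (4 / γ * ‖x‖)) :=
        add_le_add (h1.trans (mul_le_mul_of_nonneg_left h2 (by positivity))) (h3.trans (mul_le_mul_of_nonneg_left h4 (by positivity)))
    _ = _ := by ring

include hγ hCQ hβ hβ1 hQ dQ' ha coercive dD dD' dQ small hHk hHkGk in
/-- **`‖G_κ(Q_κ′g)‖ ≤ (4∕γ)(C_Q + 1)‖g‖`** (`‖G_κ‖ ≤ 4∕γ`, `‖Q_κ′‖ ≤ C_Q + β ≤ C_Q + 1`). [folklore] [cite: Balaban1985BackgroundPropagators, (3.25) p.394, (3.49) p.399] -/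
theorem norm_Ak_le (g : F) : ‖Gk (Qk' g)‖ ≤ 4 / γ * (CQ + 1) * ‖g‖ := by
  have h1 := norm_Gk_le D Q' a γ β Dk Dk' Qk Qk' Hk Gk ha hγ hβ coercive dD dD' dQ dQ' small hHk hHkGk (Qk' g)
  have h2 : ‖Qk' g‖ ≤ (CQ + 1) * ‖g‖ := norm_Qk'_le Q' CQ β Qk' hCQ hβ1 hQ dQ' g
  calc ‖Gk (Qk' g)‖ ≤ 4 / γ * ‖Qk' g‖ := h1
    _ ≤ 4 / γ * ((CQ + 1) * ‖g‖) := mul_le_mul_of_nonneg_left h2 (by positivity)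
    _ = _ := by ring

/-! ## §2 The conjugated projection against the projection -/

include ha hγ hγ1 hCQ hβ hβ1 hκ₁ coercive hQ dD dD' dQ dQ' small hH hHG hHk hHkGk hGkHk hX hc hck hkc small2 in
/-- **`‖P_κx − Px‖ ≤ β·ρ₀·‖x‖` FOR `P = G(Q′†(c(Q′(G·))))` AND ITS CONJUGATED WORD `P_κ = G_κ(Q_κ′(c_κ(Q_κ(G_κ·))))`**:
`P_κ − P = A_κ(T_κ − T) + (A_κ − A)T` with `‖A_κ‖ ≤ (4∕γ)(C_Q + 1)`, `‖T_κ − T‖ ≤ β·t₀` (§1), the seam `‖A_κ − A‖ ≤ β·s_A`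
(`B9Eq349ConjugatedGreenLetters.norm_Gk_Qk'_sub_G_adjQ_le`) and `‖T‖ ≤ (C_Q∕κ₁)(4∕γ)`; `ρ₀ = (4∕γ)(C_Q + 1)·t₀ + s_A·(C_Q∕κ₁)(4∕γ)` — the letter `ρ = β·ρ₀`
of `B9Eq326ConjugatedDeltaALetters.coercive_k_projected` (`R_κ − R = −(P_κ − P)` for `R = 1 − P`). [folklore]
[cite: Balaban1985BackgroundPropagators, (3.21) p.394, (3.25) p.394, (3.49) p.399, Thm 3.11 p.416] -/
theorem norm_Pk_sub_P_le (x : S) :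
    ‖Gk (Qk' (ck (Qk (Gk x)))) - G (LinearMap.adjoint Q' (c (Q' (G x))))‖ ≤
      β * (4 / γ * (CQ + 1) * (2 / κ₁ * (4 / γ + CQ * ((4 / γ) ^ 2 * (3 + a * (2 * CQ + 1)))) +
          2 / κ₁ * ((4 / γ + CQ * ((4 / γ) ^ 2 * (3 + a * (2 * CQ + 1)))) * (4 / γ) * (2 * CQ + 1)) * κ₁⁻¹ * (CQ * (4 / γ))) +
        (4 / γ + CQ * ((4 / γ) ^ 2 * (3 + a * (2 * CQ + 1)))) * (κ₁⁻¹ * CQ * (4 / γ))) * ‖x‖ := by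
  have e : Gk (Qk' (ck (Qk (Gk x)))) - G (LinearMap.adjoint Q' (c (Q' (G x)))) =
      Gk (Qk' (ck (Qk (Gk x)) - c (Q' (G x)))) + (Gk (Qk' (c (Q' (G x)))) - G (LinearMap.adjoint Q' (c (Q' (G x))))) := by
    rw [map_sub, map_sub]; abel
  have h1 := norm_Ak_le D Q' a γ CQ β Dk Dk' Qk Qk' Hk Gk ha hγ hCQ hβ hβ1 coercive hQ dD dD' dQ dQ' small hHk hHkGk (ck (Qk (Gk x)) - c (Q' (G x)))
  have h2 := norm_Tk_sub_T_le D Q' a γ CQ β κ₁ Dk Dk' Qk Qk' H Hk G Gk c ck ha hγ hγ1 hCQ hβ hβ1 hκ₁ coercive hQ dD dD' dQ dQ' small hH hHG hHk hHkGk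
    hGkHk hX hc hck hkc small2 x
  have h3 := norm_Gk_Qk'_sub_G_adjQ_le D Q' a γ CQ β Dk Dk' Qk Qk' H Hk G Gk ha hγ hγ1 hCQ hβ hβ1 coercive hQ dD dD' dQ dQ' small hH hHG hHk hHkGk hGkHk
    (c (Q' (G x)))
  have h4 := norm_T_le D Q' a γ CQ κ₁ H G c ha hγ hCQ hκ₁ coercive hQ hH hHG hX hc x
  have hsA : 0 ≤ 4 / γ + CQ * ((4 / γ) ^ 2 * (3 + a * (2 * CQ + 1))) := by positivity
  have ht0 : 0 ≤ 2 / κ₁ * (4 / γ + CQ * ((4 / γ) ^ 2 * (3 + a * (2 * CQ + 1)))) +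
      2 / κ₁ * ((4 / γ + CQ * ((4 / γ) ^ 2 * (3 + a * (2 * CQ + 1)))) * (4 / γ) * (2 * CQ + 1)) * κ₁⁻¹ * (CQ * (4 / γ)) := by positivity
  calc ‖Gk (Qk' (ck (Qk (Gk x)))) - G (LinearMap.adjoint Q' (c (Q' (G x))))‖
      ≤ ‖Gk (Qk' (ck (Qk (Gk x)) - c (Q' (G x))))‖ + ‖Gk (Qk' (c (Q' (G x)))) - G (LinearMap.adjoint Q' (c (Q' (G x))))‖ := by
        rw [e]; exact norm_add_le _ _
    _ ≤ 4 / γ * (CQ + 1) * (β * (2 / κ₁ * (4 / γ + CQ * ((4 / γ) ^ 2 * (3 + a * (2 * CQ + 1)))) +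
          2 / κ₁ * ((4 / γ + CQ * ((4 / γ) ^ 2 * (3 + a * (2 * CQ + 1)))) * (4 / γ) * (2 * CQ + 1)) * κ₁⁻¹ * (CQ * (4 / γ))) * ‖x‖) +
        β * (4 / γ + CQ * ((4 / γ) ^ 2 * (3 + a * (2 * CQ + 1)))) * (κ₁⁻¹ * CQ * (4 / γ) * ‖x‖) :=
        add_le_add (h1.trans (mul_le_mul_of_nonneg_left h2 (by positivity))) (h3.trans (mul_le_mul_of_nonneg_left h4 (by positivity)))
    _ = _ := by ring

end Literature.MathematicalPhysics.QuantumFieldTheory.Balaban1983to89.B9Eq349ConjugatedProjectionDifferenceLetters
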